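import Summits.Ventures.HodgeRepro2.T6A2SegreTransition
import Summits.Ventures.HodgeRepro2.T6A2ProjSmooth
import Mathlib.AlgebraicGeometry.ProjectiveSpectrum.Basic
import Mathlib.AlgebraicGeometry.Pullbacks
import Mathlib.AlgebraicGeometry.PullbackCarrier

/-!
# T6A2SegreCharts — the product charts of `ℙ(σ) ×_k ℙ(τ)`

Cell pub-hodge-repro2, Tier 6 (README §10), seat t6-p2 (A2 owner; gen 14, custodial). Towards a kernel
discharge of the A2 display `Hyp.Hartshorne1977_productProjective`. `ℙ(σ) = Proj k[Xⱼ : j ∈ σ]` with the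
host's structure map `structMap : ℙ(σ) ⟶ Spec k`; the product `prodProj = ℙ(σ) ×_{Spec k} ℙ(τ)`
(`pullback`); its product charts `prodChart : Spec (A_f ⊗ B_g) ⟶ prodProj` (`pullbackSpecIso` followed by
`pullback.map` of the charts `awayι`), open immersions with range `p⁻¹ D₊(f) ∩ q⁻¹ D₊(g)`; the cover
`prodChartCover` by the charts `D₊(Xᵢ) × D₊(Yⱼ)`; the overlap of two such charts is the basic open
`D(t)` of the first (`prodChart_apply_mem_range_iff`), and the chart transition of T6A2SegreTransition is
the inclusion of the overlap into the second chart (`SpecMap_transChart_prodChart`). Mathlib only; no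
display; no `sorry`; standard axioms. §8(d): uses an L-value-free non-vanishing device: NO.
Filed in Tier-6 WAVE 1 (2026-08-26) as p440002 (definition lane, ACCEPTED 11:13Z, commit 1589ff5e6762); this v2 differs from the filed bytes in this module docstring only (the staged-record wording dropped).
-/

namespace Summit.Ventures.HodgeRepro2.T6.A2Segre

open MvPolynomial HomogeneousLocalization TensorProduct CategoryTheory CategoryTheory.Limits
  AlgebraicGeometry Summit.Ventures.HodgeRepro2.T6.A2Surface

attribute [local instance] MvPolynomial.gradedAlgebra

universe u

variable (k : Type u) [Field k] (σ : Type u)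

/-- the structure map `ℙ(σ) = Proj k[X] ⟶ Spec k` (the host's, `projectiveSpace`) -/
noncomputable def structMap : Proj (homogeneousSubmodule σ k) ⟶ Spec (CommRingCat.of k) :=
  Proj.toSpecZero (homogeneousSubmodule σ k) ≫
    Spec.map (CommRingCat.ofHom (algebraMap k (homogeneousSubmodule σ k 0)))

variable {σ}

/-- the chart `D₊(f) = Spec A_f` lies over `Spec k` through the `k`-algebra structure of `A_f` -/
theorem awayι_structMap {f : MvPolynomial σ k} {d : ℕ} (hf : f ∈ homogeneousSubmodule σ k d)
    (hd : 0 < d) :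
    Proj.awayι _ f hf hd ≫ structMap k σ =
      Spec.map (CommRingCat.ofHom (algebraMap k (Away (homogeneousSubmodule σ k) f))) := by
  rw [structMap, Proj.awayι_toSpecZero_assoc, ← Spec.map_comp, ← CommRingCat.ofHom_comp]

/-- the cover of `ℙ(σ)` by the charts `D₊(Xᵢ)` -/
theorem iSup_basicOpen_X_eq_top :
    ⨆ i : σ, Proj.basicOpen (homogeneousSubmodule σ k) (X i) = ⊤ :=
  Proj.iSup_basicOpen_eq_top (homogeneousSubmodule σ k) X (irrelevant_le_span_range_X k)

variable (σ) (τ : Type u)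

/-- the product `ℙ(σ) ×_k ℙ(τ)` -/
noncomputable abbrev prodProj : Scheme.{u} := pullback (structMap k σ) (structMap k τ)

variable {σ τ}

section chart

variable (f : MvPolynomial σ k) (g : MvPolynomial τ k)

/-- the inclusion `A_f → A_f ⊗ B_g` -/
noncomputable def inclLeft :
    Away (homogeneousSubmodule σ k) f →+*
      Away (homogeneousSubmodule σ k) f ⊗[k] Away (homogeneousSubmodule τ k) g :=
  Algebra.TensorProduct.includeLeftRingHom

/-- `inclLeft x = x ⊗ 1` -/
theorem inclLeft_apply (x : Away (homogeneousSubmodule σ k) f) :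
    inclLeft k f g x = x ⊗ₜ[k] (1 : Away (homogeneousSubmodule τ k) g) := rfl

/-- the inclusion `B_g → A_f ⊗ B_g` -/
noncomputable def inclRight :
    Away (homogeneousSubmodule τ k) g →+*
      Away (homogeneousSubmodule σ k) f ⊗[k] Away (homogeneousSubmodule τ k) g :=
  RingHomClass.toRingHom (Algebra.TensorProduct.includeRight (R := k)
    (A := Away (homogeneousSubmodule σ k) f) (B := Away (homogeneousSubmodule τ k) g))

/-- `inclRight y = 1 ⊗ y` -/
theorem inclRight_apply (y : Away (homogeneousSubmodule τ k) g) :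
    inclRight k f g y = (1 : Away (homogeneousSubmodule σ k) f) ⊗ₜ[k] y := rfl

variable {f g} {d d' : ℕ}
  (hf : f ∈ homogeneousSubmodule σ k d) (hd : 0 < d) (hg : g ∈ homogeneousSubmodule τ k d')
  (hd' : 0 < d')

/-- the product chart `D₊(f) × D₊(g) = Spec (A_f ⊗ B_g) ⟶ ℙ(σ) ×_k ℙ(τ)` -/
noncomputable def prodChart :
    Spec (CommRingCat.of (Away (homogeneousSubmodule σ k) f ⊗[k] Away (homogeneousSubmodule τ k) g)) ⟶
      prodProj k σ τ :=
  (pullbackSpecIso k (Away (homogeneousSubmodule σ k) f) (Away (homogeneousSubmodule τ k) g)).inv ≫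
    pullback.map _ _ _ _ (Proj.awayι _ f hf hd) (Proj.awayι _ g hg hd') (𝟙 _)
      (by rw [Category.comp_id, awayι_structMap]) (by rw [Category.comp_id, awayι_structMap])

/-- a product chart is an open immersion -/
instance isOpenImmersion_prodChart : IsOpenImmersion (prodChart k hf hd hg hd') := by
  unfold prodChart
  infer_instance

/-- the first projection of a product chart is the chart `D₊(f)` through `A_f → A_f ⊗ B_g` -/
theorem prodChart_fst :
    prodChart k hf hd hg hd' ≫ pullback.fst (structMap k σ) (structMap k τ) =
      Spec.map (CommRingCat.ofHom (inclLeft k f g)) ≫ Proj.awayι _ f hf hd := by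
  rw [prodChart, Category.assoc, pullback.lift_fst, pullbackSpecIso_inv_fst_assoc]
  rfl

/-- the second projection of a product chart is the chart `D₊(g)` through `B_g → A_f ⊗ B_g` -/
theorem prodChart_snd :
    prodChart k hf hd hg hd' ≫ pullback.snd (structMap k σ) (structMap k τ) =
      Spec.map (CommRingCat.ofHom (inclRight k f g)) ≫ Proj.awayι _ g hg hd' := by
  rw [prodChart, Category.assoc, pullback.lift_snd, pullbackSpecIso_inv_snd_assoc]
  rfl

/-- pointwise form of `prodChart_fst` -/
theorem prodChart_fst_apply (w) :
    pullback.fst (structMap k σ) (structMap k τ) (prodChart k hf hd hg hd' w) =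
      Proj.awayι _ f hf hd (Spec.map (CommRingCat.ofHom (inclLeft k f g)) w) := by
  rw [← Scheme.Hom.comp_apply, prodChart_fst, Scheme.Hom.comp_apply]

/-- pointwise form of `prodChart_snd` -/
theorem prodChart_snd_apply (w) :
    pullback.snd (structMap k σ) (structMap k τ) (prodChart k hf hd hg hd' w) =
      Proj.awayι _ g hg hd' (Spec.map (CommRingCat.ofHom (inclRight k f g)) w) := by
  rw [← Scheme.Hom.comp_apply, prodChart_snd, Scheme.Hom.comp_apply]

/-- the range of a product chart is `p⁻¹ D₊(f) ∩ q⁻¹ D₊(g)` -/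
theorem range_prodChart :
    Set.range (prodChart k hf hd hg hd') =
      pullback.fst (structMap k σ) (structMap k τ) ⁻¹'
          (↑(Proj.basicOpen (homogeneousSubmodule σ k) f) : Set (Proj (homogeneousSubmodule σ k))) ∩
        pullback.snd (structMap k σ) (structMap k τ) ⁻¹'
          (↑(Proj.basicOpen (homogeneousSubmodule τ k) g) : Set (Proj (homogeneousSubmodule τ k))) := by
  have hcomp : ⇑(prodChart k hf hd hg hd') =
      ⇑(pullback.map _ _ _ _ (Proj.awayι _ f hf hd) (Proj.awayι _ g hg hd') (𝟙 _)
        (by rw [Category.comp_id, awayι_structMap]) (by rw [Category.comp_id, awayι_structMap])) ∘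
        ⇑(pullbackSpecIso k (Away (homogeneousSubmodule σ k) f)
          (Away (homogeneousSubmodule τ k) g)).inv :=
    funext fun w => Scheme.Hom.comp_apply _ _ w
  have hs : Function.Surjective ⇑(pullbackSpecIso k (Away (homogeneousSubmodule σ k) f)
      (Away (homogeneousSubmodule τ k) g)).inv :=
    (pullbackSpecIso k (Away (homogeneousSubmodule σ k) f)
      (Away (homogeneousSubmodule τ k) g)).inv.homeomorph.surjective
  rw [hcomp, hs.range_comp, Scheme.Pullback.range_map, ← Scheme.Hom.coe_opensRange,
    ← Scheme.Hom.coe_opensRange, Proj.opensRange_awayι, Proj.opensRange_awayι]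

end chart

/-- every point of the product lies on a chart `D₊(Xᵢ) × D₊(Yⱼ)` -/
theorem exists_prodChart_eq (x : prodProj k σ τ) :
    ∃ (i : σ) (j : τ) (w : Spec (CommRingCat.of (Away (homogeneousSubmodule σ k) (X i) ⊗[k]
      Away (homogeneousSubmodule τ k) (X j)))),
      prodChart k (X_mem_homogeneousSubmodule_one k i) Nat.one_pos
        (X_mem_homogeneousSubmodule_one k j) Nat.one_pos w = x := by
  have h1 : pullback.fst (structMap k σ) (structMap k τ) x ∈
      (⨆ i : σ, Proj.basicOpen (homogeneousSubmodule σ k) (X i)) := by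
    rw [iSup_basicOpen_X_eq_top]
    trivial
  have h2 : pullback.snd (structMap k σ) (structMap k τ) x ∈
      (⨆ j : τ, Proj.basicOpen (homogeneousSubmodule τ k) (X j)) := by
    rw [iSup_basicOpen_X_eq_top]
    trivial
  obtain ⟨i, hi⟩ := TopologicalSpace.Opens.mem_iSup.mp h1
  obtain ⟨j, hj⟩ := TopologicalSpace.Opens.mem_iSup.mp h2
  have : x ∈ Set.range (prodChart k (X_mem_homogeneousSubmodule_one k i) Nat.one_pos
      (X_mem_homogeneousSubmodule_one k j) Nat.one_pos) := by
    rw [range_prodChart]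
    exact ⟨hi, hj⟩
  obtain ⟨w, hw⟩ := this
  exact ⟨i, j, w, hw⟩

variable (σ τ)

/-- the open cover of `ℙ(σ) ×_k ℙ(τ)` by the product charts `D₊(Xᵢ) × D₊(Yⱼ)` -/
noncomputable def prodChartCover : (prodProj k σ τ).OpenCover :=
  Scheme.Cover.mkOfCovers (σ × τ)
    (fun ij => Spec (CommRingCat.of (Away (homogeneousSubmodule σ k) (X ij.1) ⊗[k]
      Away (homogeneousSubmodule τ k) (X ij.2))))
    (fun ij => prodChart k (X_mem_homogeneousSubmodule_one k ij.1) Nat.one_pos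
      (X_mem_homogeneousSubmodule_one k ij.2) Nat.one_pos)
    (fun x => by
      obtain ⟨i, j, w, hw⟩ := exists_prodChart_eq k x
      exact ⟨(i, j), w, hw⟩)
    (fun _ => inferInstance)

variable {σ τ}

/-- the members of the product chart cover are the product charts -/
theorem prodChartCover_f (ij : σ × τ) :
    (prodChartCover k σ τ).f ij =
      prodChart k (X_mem_homogeneousSubmodule_one k ij.1) Nat.one_pos
        (X_mem_homogeneousSubmodule_one k ij.2) Nat.one_pos := rfl

section overlap

variable (i a : σ) (j b : τ)

/-- the chart `(i, j)` applied to a point lies on the chart `(a, b)` iff the point lies in the basic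
open `D(t)`, `t = (Xₐ / Xᵢ) ⊗ (Y_b / Yⱼ)` -/
theorem prodChart_apply_mem_range_iff
    (w : Spec (CommRingCat.of (Away (homogeneousSubmodule σ k) (X i) ⊗[k]
      Away (homogeneousSubmodule τ k) (X j)))) :
    prodChart k (X_mem_homogeneousSubmodule_one k i) Nat.one_pos
        (X_mem_homogeneousSubmodule_one k j) Nat.one_pos w ∈
      Set.range (prodChart k (X_mem_homogeneousSubmodule_one k a) Nat.one_pos
        (X_mem_homogeneousSubmodule_one k b) Nat.one_pos) ↔
      w ∈ PrimeSpectrum.basicOpen (overlapElem k i a j b) := by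
  rw [range_prodChart, Set.mem_inter_iff, Set.mem_preimage, Set.mem_preimage, prodChart_fst_apply,
    prodChart_snd_apply, overlapElem_eq_mul, PrimeSpectrum.basicOpen_mul]
  have h1 : ∀ y, Proj.awayι _ (X i) (X_mem_homogeneousSubmodule_one k i) Nat.one_pos y ∈
      (↑(Proj.basicOpen (homogeneousSubmodule σ k) (X a)) : Set (Proj (homogeneousSubmodule σ k))) ↔
      y ∈ PrimeSpectrum.basicOpen (chartCoord k i a) := by
    intro y
    rw [← isLocalizationElem_eq (k := k) i a,
      ← Proj.awayι_preimage_basicOpen _ (X_mem_homogeneousSubmodule_one k i) Nat.one_pos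
        (X_mem_homogeneousSubmodule_one k a) Nat.one_pos]
    exact Iff.rfl
  have h2 : ∀ y, Proj.awayι _ (X j) (X_mem_homogeneousSubmodule_one k j) Nat.one_pos y ∈
      (↑(Proj.basicOpen (homogeneousSubmodule τ k) (X b)) : Set (Proj (homogeneousSubmodule τ k))) ↔
      y ∈ PrimeSpectrum.basicOpen (chartCoord k j b) := by
    intro y
    rw [← isLocalizationElem_eq (k := k) j b,
      ← Proj.awayι_preimage_basicOpen _ (X_mem_homogeneousSubmodule_one k j) Nat.one_pos
        (X_mem_homogeneousSubmodule_one k b) Nat.one_pos]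
    exact Iff.rfl
  rw [h1, h2]
  exact Iff.rfl

/-- the restriction to the overlap `D(t) ⊂ D₊(Xᵢ) × D₊(Yⱼ)` -/
noncomputable def overlapToChart :
    Spec (CommRingCat.of (OverlapRing k i a j b)) ⟶
      Spec (CommRingCat.of (Away (homogeneousSubmodule σ k) (X i) ⊗[k]
        Away (homogeneousSubmodule τ k) (X j))) :=
  Spec.map (CommRingCat.ofHom (algebraMap _ (OverlapRing k i a j b)))

/-- the overlap `D(t)` is an open immersion into the chart -/
instance isOpenImmersion_overlapToChart : IsOpenImmersion (overlapToChart k i a j b) := by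
  unfold overlapToChart
  infer_instance

/-- the range of the overlap inclusion is the basic open `D(t)` -/
theorem range_overlapToChart :
    Set.range (overlapToChart k i a j b) =
      (↑(PrimeSpectrum.basicOpen (overlapElem k i a j b)) : Set (PrimeSpectrum _)) := by
  show Set.range (PrimeSpectrum.comap (algebraMap _ (OverlapRing k i a j b))) = _
  exact PrimeSpectrum.localization_away_comap_range _ _

end overlap

section transition

variable {i a : σ} {j b : τ}

/-- `D₊(Xᵢ) → ℙ(σ)` restricted along a map out of `D₊(Xᵢ Xₐ)`: through `D₊(Xᵢ Xₐ) → D₊(Xᵢ)` -/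
theorem SpecMap_liftAway_awayι {R : Type u} [CommRing R]
    (F : Away (homogeneousSubmodule σ k) (X i) →+* R) (hF : IsUnit (F (chartCoord k i a))) :
    Spec.map (CommRingCat.ofHom F) ≫ Proj.awayι _ (X i) (X_mem_homogeneousSubmodule_one k i)
        Nat.one_pos =
      Spec.map (CommRingCat.ofHom (liftAway k i a F hF)) ≫
        Proj.awayι _ (X i * X a) (SetLike.mul_mem_graded (X_mem_homogeneousSubmodule_one k i)
          (X_mem_homogeneousSubmodule_one k a)) (Nat.succ_pos 1) := by
  conv_lhs => rw [← liftAway_comp_awayMap k i a F hF]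
  rw [CommRingCat.ofHom_comp, Spec.map_comp, Category.assoc, Proj.SpecMap_awayMap_awayι]

/-- `D₊(Xₐ) → ℙ(σ)` restricted along the chart transition: through `D₊(Xᵢ Xₐ) → D₊(Xₐ)` -/
theorem SpecMap_transAway_awayι {R : Type u} [CommRing R]
    (F : Away (homogeneousSubmodule σ k) (X i) →+* R) (hF : IsUnit (F (chartCoord k i a))) :
    Spec.map (CommRingCat.ofHom (transAway k i a F hF)) ≫
        Proj.awayι _ (X a) (X_mem_homogeneousSubmodule_one k a) Nat.one_pos =
      Spec.map (CommRingCat.ofHom (liftAway k i a F hF)) ≫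
        Proj.awayι _ (X i * X a) (SetLike.mul_mem_graded (X_mem_homogeneousSubmodule_one k i)
          (X_mem_homogeneousSubmodule_one k a)) (Nat.succ_pos 1) := by
  rw [transAway, CommRingCat.ofHom_comp, Spec.map_comp, Category.assoc,
    Proj.SpecMap_awayMap_awayι]

variable (i a j b)

/-- the chart transition on `Aₐ ⊗ 1` is the transition `transAway` of the left factor -/
theorem transChart_comp_inclLeft :
    (transChart k i a j b).toRingHom.comp (inclLeft k (X a) (X b)) =
      transAway k i a (leftToOverlap k i a j b).toRingHom (isUnit_leftToOverlap k i a j b) := by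
  ext x
  rw [RingHom.comp_apply, inclLeft_apply, AlgHom.toRingHom_eq_coe, RingHom.coe_coe,
    transChart_tmul, map_one, mul_one]

/-- the chart transition on `1 ⊗ B_b` is the transition `transAway` of the right factor -/
theorem transChart_comp_inclRight :
    (transChart k i a j b).toRingHom.comp (inclRight k (X a) (X b)) =
      transAway k j b (rightToOverlap k i a j b).toRingHom (isUnit_rightToOverlap k i a j b) := by
  ext x
  rw [RingHom.comp_apply, inclRight_apply, AlgHom.toRingHom_eq_coe, RingHom.coe_coe,
    transChart_tmul, map_one, one_mul]

/-- `Aᵢ → Aᵢ ⊗ Bⱼ → (Aᵢ ⊗ Bⱼ)[1 / t]` is `leftToOverlap` -/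
theorem overlapToChart_comp_inclLeft :
    (algebraMap _ (OverlapRing k i a j b)).comp (inclLeft k (X i) (X j)) =
      (leftToOverlap k i a j b).toRingHom := rfl

/-- `Bⱼ → Aᵢ ⊗ Bⱼ → (Aᵢ ⊗ Bⱼ)[1 / t]` is `rightToOverlap` -/
theorem overlapToChart_comp_inclRight :
    (algebraMap _ (OverlapRing k i a j b)).comp (inclRight k (X i) (X j)) =
      (rightToOverlap k i a j b).toRingHom := rfl

/-- **THE CHART TRANSITION IS THE INCLUSION OF THE OVERLAP INTO THE OTHER CHART**: on `Spec` of the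
overlap ring, the chart transition followed by the chart `(a, b)` is the overlap inclusion followed by
the chart `(i, j)`. -/
theorem SpecMap_transChart_prodChart :
    Spec.map (CommRingCat.ofHom (transChart k i a j b).toRingHom) ≫
        prodChart k (X_mem_homogeneousSubmodule_one k a) Nat.one_pos
          (X_mem_homogeneousSubmodule_one k b) Nat.one_pos =
      overlapToChart k i a j b ≫ prodChart k (X_mem_homogeneousSubmodule_one k i) Nat.one_pos
        (X_mem_homogeneousSubmodule_one k j) Nat.one_pos := by
  have h1 : Spec.map (CommRingCat.ofHom (transChart k i a j b).toRingHom) ≫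
      Spec.map (CommRingCat.ofHom (inclLeft k (X a) (X b))) =
      Spec.map (CommRingCat.ofHom (transAway k i a (leftToOverlap k i a j b).toRingHom
        (isUnit_leftToOverlap k i a j b))) := by
    rw [← Spec.map_comp, ← CommRingCat.ofHom_comp, transChart_comp_inclLeft]
  have h1' : overlapToChart k i a j b ≫ Spec.map (CommRingCat.ofHom (inclLeft k (X i) (X j))) =
      Spec.map (CommRingCat.ofHom (leftToOverlap k i a j b).toRingHom) := by
    rw [overlapToChart, ← Spec.map_comp, ← CommRingCat.ofHom_comp, overlapToChart_comp_inclLeft]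
  have h2 : Spec.map (CommRingCat.ofHom (transChart k i a j b).toRingHom) ≫
      Spec.map (CommRingCat.ofHom (inclRight k (X a) (X b))) =
      Spec.map (CommRingCat.ofHom (transAway k j b (rightToOverlap k i a j b).toRingHom
        (isUnit_rightToOverlap k i a j b))) := by
    rw [← Spec.map_comp, ← CommRingCat.ofHom_comp, transChart_comp_inclRight]
  have h2' : overlapToChart k i a j b ≫ Spec.map (CommRingCat.ofHom (inclRight k (X i) (X j))) =
      Spec.map (CommRingCat.ofHom (rightToOverlap k i a j b).toRingHom) := by
    rw [overlapToChart, ← Spec.map_comp, ← CommRingCat.ofHom_comp, overlapToChart_comp_inclRight]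
  apply pullback.hom_ext
  · rw [Category.assoc, Category.assoc, prodChart_fst, prodChart_fst, ← Category.assoc, h1,
      ← Category.assoc, h1',
      SpecMap_transAway_awayι k (leftToOverlap k i a j b).toRingHom (isUnit_leftToOverlap k i a j b),
      SpecMap_liftAway_awayι k (leftToOverlap k i a j b).toRingHom (isUnit_leftToOverlap k i a j b)]
  · rw [Category.assoc, Category.assoc, prodChart_snd, prodChart_snd, ← Category.assoc, h2,
      ← Category.assoc, h2',
      SpecMap_transAway_awayι k (rightToOverlap k i a j b).toRingHom
        (isUnit_rightToOverlap k i a j b),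
      SpecMap_liftAway_awayι k (rightToOverlap k i a j b).toRingHom
        (isUnit_rightToOverlap k i a j b)]

end transition

end Summit.Ventures.HodgeRepro2.T6.A2Segre
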